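import Summits.QuantumFields.YangMills.Theorems.FluctuationComparisonRegPrIntLLoopLedgerGasOfProductFormula
import Summits.QuantumFields.YangMills.Theorems.FluctuationComparisonRegPrIntLS2BetaKPLogRep
import HarnessLib

/-!
# THE PRODUCT-FORMULA DOOR OF LINE g19-2, KOTECKÝ–PREISS EDITION: a λ-family of KP gases whose pinned size tends to zero has `log Ξ(w^λ_U) → 0`
# (and `Ξ > 0`) — so the expansion hand's contract for GAS is «product formula + KP majorants at every λ», nothing analytic left

Cell `ym3-torus` (YM ladder rung R3 = continuum `SU(2)` Yang–Mills on the three-torus — a RUNG, NOT d = 4, NOT infinite volume, NOT a mass gap, NOT Clay).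
Width seat `ym3-torus-px20` (gen 15); `--supports stmt-QuantumFields-20520 --as helper`, count-neutral, definition-free, default heartbeats; registry v11.4 №36
untouched.  Sequel of ✓`…LoopLedgerGasOfProductFormula` (p783037): there, ⟨ECE⟩ → ⟨GAS⟩ with ⟨ECE⟩ displaying, besides the product formula
`heightDensityCan(γ∕λ)·e^{β_K(γ∕λ)m} = C_λ·ℓ(U)·Ξ(w^λ_U)` and the KP gas at `λ = 1`, two ANALYTIC clauses: `0 < Ξ(w^λ_U)` and `log Ξ(w^λ_U) → 0` (`λ → ∞`).
THIS FILE discharges both from what a cluster expansion natively delivers — Kotecký–Preiss majorants at every `λ ≥ 1` with a pinned size `N_λ → 0`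
([KoteckyPreiss1986] Theorem p.492: zero-freeness + the one-polymer ratio bounds `e^{−x_γ} ≤ |Ξ(Λ∖γ)∕Ξ(Λ)| ≤ e^{x_γ}`; for real activities `Ξ > 0` and
`|log Ξ| ≤ Σ_γ x_γ ≤ |bonds|·N`).
* §1 ★ `abs_log_norm_polymerPartitionFunction_le` (GENERIC, any finite polymer system, complex activities): under `IsKPVolume inc w a Λ`,
  `|log ‖Ξ(Λ′)‖| ≤ Σ_{γ ∈ Λ′} ‖w γ‖e^{a γ}` for every `Λ′ ⊆ Λ` (telescoping lit ✓`polymerPartitionFunction_kp_bounds`).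
* §2 `sum_le_sum_card_mul_of_empty`, `sum_filter_mem_eq_sum_card_mul` (pinning a sum over nonempty polymers on their bonds); ★ `gasZ_pos_and_abs_log_le` — for the
  line's REAL bond-polymer gas (the `KPGasOn` text of LINE g19-1∕g19-2, unfolded as in ✓`…S2BetaKPLogRep.kpLogRep`): at every window point `Ξ(w_U) > 0` and
  `|log Ξ(w_U)| ≤ |PBond|·N`.
* §3 ★ `tendsto_log_gasZ_of_kpFamily` — a λ-family of such gases with pinned sizes `N_λ → 0` has `log Ξ(w^λ_U) → 0` on the window.
* §4 ★★ `beyondOneLoopGas_of_productFormula_kp : ⟨ECE-KP⟩ → ⟨BeyondOneLoopGasCan VERBATIM (δ-unfolded)⟩` (GAS₁ then follows by the line's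
  ✓`loopLedgerDepthOneGas_of_gas`; a depth-one-only hand uses §2–§3 + ✓`loopLedgerDepthOneGas_of_productFormula`), ⟨ECE-KP⟩ = GAS's prefix VERBATIM, then `∀ J K hJK, ∃ Cl ell w Nf, (∀ λ ≥ 1, 0 < Cl λ) ∧ (∀ U ∈ window, 0 < ell U) ∧ KPGasOn window κ (Φ J) (w 1) ∧
  Tendsto Nf atTop (𝓝 0) ∧ (∀ λ ≥ 1, KPGasOn window κ (Nf λ) (w λ)) ∧ (∀ λ ≥ 1, ∀ U ∈ window, product formula)`.

HONEST SCOPE.  [folklore]∕[KP86] bookkeeping over landed Literature∕Summits theorems; ⟨ECE-KP⟩ is a HYPOTHESIS (the small-field cluster expansion in product form with its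
majorants — [Balaban1987RG1] Thm 1 ∕ [Balaban1988Convergent] read in d = 3 — XL, nobody's theorem); nothing of Bałaban's is asserted or proved; GAS, GAS₁, REP, H4ᶜ, S2β,
the five registered ∘-stubs and `FluctuationComparisonRegPrIntL` (stmt-QuantumFields-20520) are NOT proved; no summit statement is proved by a helper; rung R3 = SU(2) YM₃
on T³ — NOT d = 4, NOT infinite volume, NOT a mass gap, NOT Clay; the Yang–Mills mass gap is NOT proved.

References: R. Kotecký, D. Preiss, CMP **103** (1986) 491–498 [KoteckyPreiss1986] (Theorem p.492 (1)–(2)); T. Bałaban, CMP **109** (1987) 249–301 [Balaban1987RG1]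
(Thm 1, (0.22)–(0.26)); CMP **122** (1989) 355–392 [Balaban1989LargeFieldII] ((1.90) p.388, (1.97)–(1.100) pp.389–390).
-/

set_option autoImplicit false

noncomputable section

open MeasureTheory Filter Topology Set
open Literature.Probability.LatticeModels
open Literature.MathematicalPhysics.QuantumFieldTheory.Balaban1983to89
open Literature.MathematicalPhysics.QuantumFieldTheory.Balaban1983to89.T3ContinuumYM3Torus
open Literature.MathematicalPhysics.QuantumFieldTheory.Balaban1983to89.T3NestedUnitLaws
open Literature.MathematicalPhysics.QuantumFieldTheory.Balaban1983to89.T3UnitLawDensityEML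
open Literature.MathematicalPhysics.QuantumFieldTheory.Balaban1983to89.T3UnitScaleTilt
open Literature.MathematicalPhysics.QuantumFieldTheory.Balaban1983to89.T3TiltDescent
open Literature.MathematicalPhysics.QuantumFieldTheory.Balaban1983to89.T3PrintedRegularMinimiser
open Summit.QuantumFields.YangMills.Theorems.FluctuationComparisonRegPrIntLS2BetaKPLIncrement
open Summit.QuantumFields.YangMills.Theorems.FluctuationComparisonRegPrIntLS2BetaKPLExpansion

namespace Summit.QuantumFields.YangMills.Theorems.LoopLedgerGasOfProductFormula

/-! ## §1 Generic: the logarithm of a Kotecký–Preiss partition function is bounded by the sum of the KP sizes -/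

section GenericKP

variable {P : Type*} [DecidableEq P] {inc : P → P → Prop} [DecidableRel inc] [Std.Refl inc] [Std.Symm inc]

/-- ★ **`|log ‖Ξ(Λ′)‖| ≤ Σ_{γ ∈ Λ′} ‖w γ‖·e^{a γ}` on a KP volume** (complex activities; telescoping the one-polymer ratio bounds
`e^{−x_γ} ≤ ‖Ξ(Λ′∖γ)∕Ξ(Λ′)‖ ≤ e^{x_γ}` of lit ✓`polymerPartitionFunction_kp_bounds`). [cite: KoteckyPreiss1986, Theorem p.492 (1)-(2)] -/
theorem abs_log_norm_polymerPartitionFunction_le {w : P → ℂ} {a : P → ℝ} {Λ : Finset P} (hKP : IsKPVolume inc w a Λ) :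
    ∀ Λ' ⊆ Λ, |Real.log ‖polymerPartitionFunction inc w Λ'‖| ≤ ∑ γ ∈ Λ', kpTerm w a γ := by
  intro Λ'
  induction Λ' using Finset.induction_on with
  | empty => intro _; simp
  | insert γ Λ' hγ ih =>
    intro hsub
    have hΛ'sub : Λ' ⊆ Λ := (Finset.subset_insert γ Λ').trans hsub
    have hb := hKP |> polymerPartitionFunction_kp_bounds (inc := inc)
    obtain ⟨hZne, hrat⟩ := hb (insert γ Λ') hsub
    obtain ⟨hup, hlow, -⟩ := hrat γ (Finset.mem_insert_self γ Λ')
    have hZ'ne : polymerPartitionFunction inc w Λ' ≠ 0 := (hb Λ' hΛ'sub).1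
    rw [Finset.erase_insert hγ] at hup hlow
    set Z := polymerPartitionFunction inc w (insert γ Λ') with hZ
    set Z' := polymerPartitionFunction inc w Λ' with hZ'
    have hZpos : 0 < ‖Z‖ := norm_pos_iff.2 hZne
    have hZ'pos : 0 < ‖Z'‖ := norm_pos_iff.2 hZ'ne
    have hr : ‖Z' / Z‖ = ‖Z'‖ / ‖Z‖ := norm_div _ _
    rw [hr] at hup hlow
    have hrpos : 0 < ‖Z'‖ / ‖Z‖ := div_pos hZ'pos hZpos
    -- `log ‖Z‖ = log ‖Z'‖ − log (‖Z'‖ ∕ ‖Z‖)` and `|log (‖Z'‖ ∕ ‖Z‖)| ≤ x_γ`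
    have hlogeq : Real.log ‖Z‖ = Real.log ‖Z'‖ - Real.log (‖Z'‖ / ‖Z‖) := by
      rw [Real.log_div hZ'pos.ne' hZpos.ne']; ring
    have habs : |Real.log (‖Z'‖ / ‖Z‖)| ≤ kpTerm w a γ := by
      rw [abs_le]
      constructor
      · have := Real.log_le_log (Real.exp_pos _) hlow
        rwa [Real.log_exp] at this
      · have := Real.log_le_log hrpos hup
        rwa [Real.log_exp] at this
    rw [Finset.sum_insert hγ, hlogeq]
    calc |Real.log ‖Z'‖ - Real.log (‖Z'‖ / ‖Z‖)|
        ≤ |Real.log ‖Z'‖| + |Real.log (‖Z'‖ / ‖Z‖)| := abs_sub _ _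
      _ ≤ (∑ γ' ∈ Λ', kpTerm w a γ') + kpTerm w a γ := add_le_add (ih hΛ'sub) habs
      _ = kpTerm w a γ + ∑ γ' ∈ Λ', kpTerm w a γ' := add_comm _ _

end GenericKP

/-! ## §2 The line's real bond-polymer gas: `Ξ(w_U) > 0` and `|log Ξ(w_U)| ≤ |PBond|·N` from the `KPGasOn` data -/

section RealGas

variable {B : Type*} [Fintype B] [DecidableEq B]

omit [DecidableEq B] in
/-- A nonnegative function vanishing at `∅` is dominated termwise by `|X|·h X`. [folklore] -/
theorem sum_le_sum_card_mul_of_empty (h : Finset B → ℝ) (h0 : ∀ X, 0 ≤ h X) (hempty : h ∅ = 0) :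
    ∑ X : Finset B, h X ≤ ∑ X : Finset B, (X.card : ℝ) * h X := by
  refine Finset.sum_le_sum fun X _ => ?_
  rcases X.eq_empty_or_nonempty with hX | hX
  · rw [hX, hempty, mul_zero]
  · have : (1 : ℝ) ≤ X.card := by exact_mod_cast Finset.card_pos.2 hX
    nlinarith [h0 X]

/-- Pinning on bonds: `Σ_e Σ_{X ∋ e} h X = Σ_X |X|·h X`. [folklore] -/
theorem sum_filter_mem_eq_sum_card_mul (h : Finset B → ℝ) :
    ∑ e : B, ∑ X ∈ Finset.univ.filter (fun X : Finset B => e ∈ X), h X = ∑ X : Finset B, (X.card : ℝ) * h X := by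
  rw [Finset.sum_comm' (t' := Finset.univ) (s' := fun X => X) (fun e X => by simp)]
  refine Finset.sum_congr rfl fun X _ => ?_
  rw [Finset.sum_const, nsmul_eq_mul]

open Classical in
/-- ★ **Positivity and the log bound for the line's real gas.**  For real V-local activities `w` on the bond polymers with the `KPGasOn` data of LINE g19-1∕g19-2
(`w U ∅ = 0`, majorant `w̄ ≥ |w_U|` at the window point `U`, lengths `ℓ ≥ 0`, rate `κ ≥ 0`, KP inequality with size `a`, pinned size `a{e} ≤ N`):
`Ξ(w_U) > 0` and `|log Ξ(w_U)| ≤ |B|·N`. [cite: KoteckyPreiss1986, Theorem p.492 (1)-(2); Balaban1989LargeFieldII, (1.97)-(1.100) pp.389-390] -/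
theorem gasZ_pos_and_abs_log_le {G : Type*} {κ N : ℝ} (hκ : 0 ≤ κ) (w : (B → G) → Finset B → ℝ) (wbar a ℓ : Finset B → ℝ)
    (U : B → G) (hw0 : w U ∅ = 0) (hℓ : ∀ X, 0 ≤ ℓ X) (hdom : ∀ X, |w U X| ≤ wbar X)
    (hKP : ∀ X : Finset B, ∑ X' ∈ Finset.univ.filter (fun X' => polyInc X' X), wbar X' * Real.exp (a X' + κ * ℓ X') ≤ a X)
    (hpin : ∀ e : B, a {e} ≤ N) :
    0 < (polymerPartitionFunction polyInc (fun X : Finset B => ((w U X : ℝ) : ℂ)) Finset.univ).re ∧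
      |Real.log (polymerPartitionFunction polyInc (fun X : Finset B => ((w U X : ℝ) : ℂ)) Finset.univ).re| ≤ (Fintype.card B : ℝ) * N := by
  have hwbar0 : ∀ X, 0 ≤ wbar X := fun X => (abs_nonneg _).trans (hdom X)
  -- the finite-volume KP condition for the complexified real activities
  have hKPU : IsKPVolume polyInc (fun X : Finset B => ((w U X : ℝ) : ℂ)) a (Finset.univ : Finset (Finset B)) := by
    intro X _
    refine le_trans (Finset.sum_le_sum fun X' _ => ?_) (hKP X)
    unfold kpTerm
    rw [Complex.norm_real, Real.norm_eq_abs]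
    refine mul_le_mul (hdom X') (Real.exp_le_exp.2 (by nlinarith [hℓ X'])) (Real.exp_nonneg _) (hwbar0 X')
  have hpos := FluctuationComparisonRegPrIntLS2BetaKPLIncrement.re_polymerPartitionFunction_pos_of_kp (inc := polyInc) hKPU le_rfl
  refine ⟨hpos, ?_⟩
  -- `Ξ` is a positive real, so `log Re Ξ = log ‖Ξ‖`
  have hnorm : ‖polymerPartitionFunction polyInc (fun X : Finset B => ((w U X : ℝ) : ℂ)) Finset.univ‖ =
      (polymerPartitionFunction polyInc (fun X : Finset B => ((w U X : ℝ) : ℂ)) Finset.univ).re := by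
    rw [FluctuationComparisonRegPrIntLS2BetaKPLIncrement.polymerPartitionFunction_ofReal_eq_re (inc := polyInc) (w U) Finset.univ, Complex.norm_real, Complex.ofReal_re,
      Real.norm_eq_abs, abs_of_pos hpos]
  rw [← hnorm]
  refine (abs_log_norm_polymerPartitionFunction_le hKPU Finset.univ le_rfl).trans ?_
  -- `Σ_X x_X ≤ Σ_X |X|·g X = Σ_e Σ_{X ∋ e} g X ≤ Σ_e a{e} ≤ |B|·N`, `g X := w̄ X e^{a X + κ ℓ X}`
  set g : Finset B → ℝ := fun X => wbar X * Real.exp (a X + κ * ℓ X) with hg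
  have hg0 : ∀ X, 0 ≤ g X := fun X => mul_nonneg (hwbar0 X) (Real.exp_nonneg _)
  have hxg : ∀ X, kpTerm (fun X : Finset B => ((w U X : ℝ) : ℂ)) a X ≤ g X := fun X => by
    unfold kpTerm
    rw [Complex.norm_real, Real.norm_eq_abs]
    exact mul_le_mul (hdom X) (Real.exp_le_exp.2 (by nlinarith [hℓ X])) (Real.exp_nonneg _) (hwbar0 X)
  have hx0 : kpTerm (fun X : Finset B => ((w U X : ℝ) : ℂ)) a ∅ = 0 := by
    unfold kpTerm; simp [hw0]
  calc ∑ X : Finset B, kpTerm (fun X : Finset B => ((w U X : ℝ) : ℂ)) a X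
      ≤ ∑ X : Finset B, (X.card : ℝ) * kpTerm (fun X : Finset B => ((w U X : ℝ) : ℂ)) a X :=
        sum_le_sum_card_mul_of_empty _ (fun X => kpTerm_nonneg _ _ _) hx0
    _ ≤ ∑ X : Finset B, (X.card : ℝ) * g X :=
        Finset.sum_le_sum fun X _ => mul_le_mul_of_nonneg_left (hxg X) (Nat.cast_nonneg _)
    _ = ∑ e : B, ∑ X ∈ Finset.univ.filter (fun X : Finset B => e ∈ X), g X := (sum_filter_mem_eq_sum_card_mul g).symm
    _ ≤ ∑ e : B, ∑ X' ∈ Finset.univ.filter (fun X' => polyInc X' ({e} : Finset B)), g X' := by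
        refine Finset.sum_le_sum fun e _ => Finset.sum_le_sum_of_subset_of_nonneg ?_ fun X _ _ => hg0 X
        intro X hX
        rw [Finset.mem_filter] at hX ⊢
        exact ⟨hX.1, FluctuationComparisonRegPrIntLS2BetaKPLogRep.polyInc_singleton_of_mem hX.2⟩
    _ ≤ ∑ _e : B, N := Finset.sum_le_sum fun e _ => (hKP {e}).trans (hpin e)
    _ = (Fintype.card B : ℝ) * N := by rw [Finset.sum_const, nsmul_eq_mul, Finset.card_univ]

end RealGas

/-! ## §3 A λ-family of KP gases with pinned sizes `N_λ → 0` has `log Ξ(w^λ_U) → 0` -/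

section Family

variable {B : Type*} [Fintype B] [DecidableEq B] {G : Type*}

open Classical in
/-- ★ **`log Ξ(w^λ_U) → 0`** when, for every `λ ≥ 1`, the real activities `w λ` admit Kotecký–Preiss data at the point `U` (`w λ U ∅ = 0`, a majorant
`w̄ ≥ |w^λ_U|`, lengths `ℓ ≥ 0`, the KP inequality with size `a` at rate `κ ≥ 0`) with pinned size `a{e} ≤ Nf λ`, and `Nf λ → 0`: squeeze by §2's
`|log Ξ| ≤ |B|·Nf λ`. [cite: KoteckyPreiss1986, Theorem p.492 (1)-(2)] -/
theorem tendsto_log_gasZ_of_kpFamily {κ : ℝ} (hκ : 0 ≤ κ) (Nf : ℝ → ℝ) (hN : Tendsto Nf atTop (𝓝 0))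
    (w : ℝ → (B → G) → Finset B → ℝ) (U : B → G)
    (hgas : ∀ lam : ℝ, 1 ≤ lam → ∃ (wbar a ℓ : Finset B → ℝ),
      w lam U ∅ = 0 ∧ (∀ X, 0 ≤ ℓ X) ∧ (∀ X, |w lam U X| ≤ wbar X) ∧
      (∀ X : Finset B, ∑ X' ∈ Finset.univ.filter (fun X' => polyInc X' X),
          wbar X' * Real.exp (a X' + κ * ℓ X') ≤ a X) ∧
      (∀ e : B, a {e} ≤ Nf lam)) :
    Tendsto (fun lam : ℝ => Real.log (polymerPartitionFunction polyInc (fun X : Finset B => ((w lam U X : ℝ) : ℂ)) Finset.univ).re)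
      atTop (𝓝 0) := by
  have hbound : ∀ᶠ lam : ℝ in atTop,
      ‖Real.log (polymerPartitionFunction polyInc (fun X : Finset B => ((w lam U X : ℝ) : ℂ)) Finset.univ).re‖ ≤ (Fintype.card B : ℝ) * Nf lam := by
    filter_upwards [eventually_ge_atTop (1 : ℝ)] with lam hlam
    obtain ⟨wbar, a, ℓ, hw0, hℓ, hdom, hKP, hpin⟩ := hgas lam hlam
    rw [Real.norm_eq_abs]
    exact (gasZ_pos_and_abs_log_le hκ (w lam) wbar a ℓ U hw0 hℓ hdom hKP hpin).2
  have hlim : Tendsto (fun lam : ℝ => (Fintype.card B : ℝ) * Nf lam) atTop (𝓝 0) := by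
    simpa using hN.const_mul (Fintype.card B : ℝ)
  exact squeeze_zero_norm' hbound hlim

end Family

/-! ## §4 The door ⟨ECE-KP⟩ → ⟨GAS⟩ — the expansion hand's contract is «product formula + KP majorants at every λ» -/

section Doors

open Classical in
/-- ★★ **⟨ECE-KP⟩ → ⟨GAS⟩.**  Hypothesis ⟨ECE-KP⟩: GAS's quantifier prefix VERBATIM; then at every depth a datum-free Gaussian normalisation `Cl λ > 0`, a λ-free
semiclassical constant `ell > 0` on the window, real V-local activities `w λ`, a pinned-size profile `Nf λ → 0`, the `KPGasOn` text at `λ = 1` with size `Φ J` AND at every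
`λ ≥ 1` with size `Nf λ`, and the PRODUCT FORMULA `heightDensityCan F (γ∕λ) U · exp(β_K(γ∕λ)·minActionRegPr U) = Cl λ · ell U · Ξ(w^λ_U)` on the window.  Conclusion:
`BeyondOneLoopGasCan` of LINE g19-2 VERBATIM (δ-unfolded).  Proof: §2 gives `Ξ(w^λ_U) > 0`, §3 gives `log Ξ(w^λ_U) → 0`, then the product-formula door
(✓`log_add_eq_of_mul_exp_eq`, ✓`eq_const_add_limUnder_add_of_split`; `γ₁ ↦ min γ₁ 1` for the window datum `1`).
[cite: Balaban1987RG1, Thm 1 (0.19)-(0.26) pp.255-257; Balaban1989LargeFieldII, (1.90) p.388, (1.97)-(1.100) pp.389-390; KoteckyPreiss1986, Theorem p.492] -/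
theorem beyondOneLoopGas_of_productFormula_kp
    (hECE : ∀ (L : ℕ), ∃ pS : ℝ, ∀ (b₀ p₀ : ℝ), 0 < b₀ → pS ≤ p₀ → 0 < p₀ → ∃ ε₁ : ℝ, 0 < ε₁ ∧ ∀ (ε₀ : ℝ), 0 < ε₀ → ε₀ ≤ ε₁ →
      ∃ γ₁ : ℝ, 0 < γ₁ ∧ ∃ κ : ℝ, 0 < κ ∧
        ∀ (F : T3Family) (γ : ℝ), F.L = L → 0 < γ → γ ≤ γ₁ →
          ∃ Φ : ℕ → ℝ, (∀ J, 0 ≤ Φ J) ∧ Tendsto (fun J : ℕ => (J : ℝ) * Φ J) atTop (𝓝 0) ∧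
            ∀ (J K : ℕ) (hJK : J ≤ K),
              ∃ (Cl : ℝ → ℝ) (ell : GaugeField (F.P J) 0 (Matrix.specialUnitaryGroup (Fin 2) ℂ) → ℝ)
                (w : ℝ → GaugeField (F.P J) 0 (Matrix.specialUnitaryGroup (Fin 2) ℂ) → Finset (PBond (F.P J) 0) → ℝ) (Nf : ℝ → ℝ),
              (∀ lam : ℝ, 1 ≤ lam → 0 < Cl lam) ∧
              (∀ U : GaugeField (F.P J) 0 (Matrix.specialUnitaryGroup (Fin 2) ℂ), PlaqSmall (θBal F.L γ b₀ p₀ J) U → 0 < ell U) ∧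
              (∃ (wbar a ℓ : Finset (PBond (F.P J) 0) → ℝ),
                (∀ U, w 1 U ∅ = 0) ∧
                (∀ (X : Finset (PBond (F.P J) 0)) (U U' : GaugeField (F.P J) 0 (Matrix.specialUnitaryGroup (Fin 2) ℂ)),
                  (∀ e ∈ X, U e = U' e) → w 1 U X = w 1 U' X) ∧
                (∀ X, 0 ≤ a X) ∧ (∀ X, 0 ≤ ℓ X) ∧
                (∀ U, U ∈ {U : GaugeField (F.P J) 0 (Matrix.specialUnitaryGroup (Fin 2) ℂ) | PlaqSmall (θBal F.L γ b₀ p₀ J) U} → ∀ X, |w 1 U X| ≤ wbar X) ∧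
                (∀ X : Finset (PBond (F.P J) 0), ∀ e ∈ X, ∀ e' ∈ X, (e.src.tdist e'.src : ℝ) ≤ ℓ X) ∧
                (∀ X : Finset (PBond (F.P J) 0), ∑ X' ∈ Finset.univ.filter (fun X' => polyInc X' X),
                    wbar X' * Real.exp (a X' + κ * ℓ X') ≤ a X) ∧
                (∀ e : PBond (F.P J) 0, a {e} ≤ (Φ J))) ∧
              Tendsto Nf atTop (𝓝 0) ∧
              (∀ lam : ℝ, 1 ≤ lam → (∃ (wbar a ℓ : Finset (PBond (F.P J) 0) → ℝ),
                (∀ U, w lam U ∅ = 0) ∧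
                (∀ (X : Finset (PBond (F.P J) 0)) (U U' : GaugeField (F.P J) 0 (Matrix.specialUnitaryGroup (Fin 2) ℂ)),
                  (∀ e ∈ X, U e = U' e) → w lam U X = w lam U' X) ∧
                (∀ X, 0 ≤ a X) ∧ (∀ X, 0 ≤ ℓ X) ∧
                (∀ U, U ∈ {U : GaugeField (F.P J) 0 (Matrix.specialUnitaryGroup (Fin 2) ℂ) | PlaqSmall (θBal F.L γ b₀ p₀ J) U} → ∀ X, |w lam U X| ≤ wbar X) ∧
                (∀ X : Finset (PBond (F.P J) 0), ∀ e ∈ X, ∀ e' ∈ X, (e.src.tdist e'.src : ℝ) ≤ ℓ X) ∧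
                (∀ X : Finset (PBond (F.P J) 0), ∑ X' ∈ Finset.univ.filter (fun X' => polyInc X' X),
                    wbar X' * Real.exp (a X' + κ * ℓ X') ≤ a X) ∧
                (∀ e : PBond (F.P J) 0, a {e} ≤ Nf lam))) ∧
              (∀ lam : ℝ, 1 ≤ lam → ∀ U : GaugeField (F.P J) 0 (Matrix.specialUnitaryGroup (Fin 2) ℂ), PlaqSmall (θBal F.L γ b₀ p₀ J) U →
                Node00.canonVersion (fieldMeasure (F.P J) 0 (Matrix.specialUnitaryGroup (Fin 2) ℂ))
                    (heightDensity F (γ / lam) hJK (histGood F ℰp (θBal F.L γ b₀ p₀) K J)) U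
                  * Real.exp ((F.scheme ℰp (γ / lam)).β K * minActionRegPr F J K hJK ε₀ U)
                = Cl lam * ell U * (polymerPartitionFunction polyInc (fun X : Finset (PBond (F.P J) 0) => ((w lam U X : ℝ) : ℂ)) Finset.univ).re)) :
    ∀ (L : ℕ), ∃ pS : ℝ, ∀ (b₀ p₀ : ℝ), 0 < b₀ → pS ≤ p₀ → 0 < p₀ → ∃ ε₁ : ℝ, 0 < ε₁ ∧ ∀ (ε₀ : ℝ), 0 < ε₀ → ε₀ ≤ ε₁ →
      ∃ γ₁ : ℝ, 0 < γ₁ ∧ ∃ κ : ℝ, 0 < κ ∧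
        ∀ (F : T3Family) (γ : ℝ), F.L = L → 0 < γ → γ ≤ γ₁ →
          ∃ Φ : ℕ → ℝ, (∀ J, 0 ≤ Φ J) ∧ Tendsto (fun J : ℕ => (J : ℝ) * Φ J) atTop (𝓝 0) ∧
            ∀ (J K : ℕ) (hJK : J ≤ K),
              ∃ (c : ℝ) (w : GaugeField (F.P J) 0 (Matrix.specialUnitaryGroup (Fin 2) ℂ) → Finset (PBond (F.P J) 0) → ℝ),
                (∃ (wbar a ℓ : Finset (PBond (F.P J) 0) → ℝ),
                (∀ U, w U ∅ = 0) ∧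
                (∀ (X : Finset (PBond (F.P J) 0)) (U U' : GaugeField (F.P J) 0 (Matrix.specialUnitaryGroup (Fin 2) ℂ)),
                  (∀ e ∈ X, U e = U' e) → w U X = w U' X) ∧
                (∀ X, 0 ≤ a X) ∧ (∀ X, 0 ≤ ℓ X) ∧
                (∀ U, U ∈ {U : GaugeField (F.P J) 0 (Matrix.specialUnitaryGroup (Fin 2) ℂ) | PlaqSmall (θBal F.L γ b₀ p₀ J) U} → ∀ X, |w U X| ≤ wbar X) ∧
                (∀ X : Finset (PBond (F.P J) 0), ∀ e ∈ X, ∀ e' ∈ X, (e.src.tdist e'.src : ℝ) ≤ ℓ X) ∧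
                (∀ X : Finset (PBond (F.P J) 0), ∑ X' ∈ Finset.univ.filter (fun X' => polyInc X' X),
                    wbar X' * Real.exp (a X' + κ * ℓ X') ≤ a X) ∧
                (∀ e : PBond (F.P J) 0, a {e} ≤ (Φ J))) ∧
                ∀ U : GaugeField (F.P J) 0 (Matrix.specialUnitaryGroup (Fin 2) ℂ), PlaqSmall (θBal F.L γ b₀ p₀ J) U →
                  (Real.log (Node00.canonVersion (fieldMeasure (F.P J) 0 (Matrix.specialUnitaryGroup (Fin 2) ℂ))
                      (heightDensity F (γ / 1) hJK (histGood F ℰp (θBal F.L γ b₀ p₀) K J)) U)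
                    + (F.scheme ℰp (γ / 1)).β K * minActionRegPr F J K hJK ε₀ U)
                    = c + limUnder atTop (fun lam : ℝ => (Real.log (Node00.canonVersion (fieldMeasure (F.P J) 0 (Matrix.specialUnitaryGroup (Fin 2) ℂ))
                      (heightDensity F (γ / lam) hJK (histGood F ℰp (θBal F.L γ b₀ p₀) K J)) U)
                    + (F.scheme ℰp (γ / lam)).β K * minActionRegPr F J K hJK ε₀ U) - (Real.log (Node00.canonVersion (fieldMeasure (F.P J) 0 (Matrix.specialUnitaryGroup (Fin 2) ℂ))
                      (heightDensity F (γ / lam) hJK (histGood F ℰp (θBal F.L γ b₀ p₀) K J)) 1)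
                    + (F.scheme ℰp (γ / lam)).β K * minActionRegPr F J K hJK ε₀ 1))
                      + Real.log (polymerPartitionFunction polyInc (fun X : Finset (PBond (F.P J) 0) => ((w U X : ℝ) : ℂ)) Finset.univ).re := by
  intro L
  obtain ⟨pS, H⟩ := hECE L
  refine ⟨pS, fun b₀ p₀ hb hp hp0 => ?_⟩
  obtain ⟨ε₁, hε₁, H1⟩ := H b₀ p₀ hb hp hp0
  refine ⟨ε₁, hε₁, fun ε₀ hε₀ hε₀le => ?_⟩
  obtain ⟨γ₁, hγ₁, κ, hκ, H2⟩ := H1 ε₀ hε₀ hε₀le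
  refine ⟨min γ₁ 1, lt_min hγ₁ one_pos, κ, hκ, fun F γ hFL hγ hγle => ?_⟩
  obtain ⟨Φ, hΦ0, hΦ, H3⟩ := H2 F γ hFL hγ (hγle.trans (min_le_left _ _))
  refine ⟨Φ, hΦ0, hΦ, fun J K hJK => ?_⟩
  obtain ⟨Cl, ell, w, Nf, hCl, hell, hgas, hN, hgasL, hprod⟩ := H3 J K hJK
  have h1 : PlaqSmall (θBal F.L γ b₀ p₀ J) (1 : GaugeField (F.P J) 0 (Matrix.specialUnitaryGroup (Fin 2) ℂ)) :=
    T3DescentFibreTower.plaqSmall_one (T3MinimiserStabilityReduction.θBal_pos (le_of_lt F.hL.2) hγ (hγle.trans (min_le_right _ _)) hb p₀ J)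
  -- the KP data at a window point, per `λ ≥ 1`
  have hdata : ∀ U : GaugeField (F.P J) 0 (Matrix.specialUnitaryGroup (Fin 2) ℂ), PlaqSmall (θBal F.L γ b₀ p₀ J) U → ∀ lam : ℝ, 1 ≤ lam →
      ∃ (wbar a ℓ : Finset (PBond (F.P J) 0) → ℝ),
        w lam U ∅ = 0 ∧ (∀ X, 0 ≤ ℓ X) ∧ (∀ X, |w lam U X| ≤ wbar X) ∧
        (∀ X : Finset (PBond (F.P J) 0), ∑ X' ∈ Finset.univ.filter (fun X' => polyInc X' X),
            wbar X' * Real.exp (a X' + κ * ℓ X') ≤ a X) ∧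
        (∀ e : PBond (F.P J) 0, a {e} ≤ Nf lam) := by
    intro U hU lam hlam
    obtain ⟨wbar, a, ℓ, hw0, -, -, hℓ, hdom, -, hKP, hpin⟩ := hgasL lam hlam
    exact ⟨wbar, a, ℓ, hw0 U, hℓ, hdom U hU, hKP, hpin⟩
  have hZpos : ∀ lam : ℝ, 1 ≤ lam → ∀ U : GaugeField (F.P J) 0 (Matrix.specialUnitaryGroup (Fin 2) ℂ), PlaqSmall (θBal F.L γ b₀ p₀ J) U →
      0 < (polymerPartitionFunction polyInc (fun X : Finset (PBond (F.P J) 0) => ((w lam U X : ℝ) : ℂ)) Finset.univ).re := by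
    intro lam hlam U hU
    obtain ⟨wbar, a, ℓ, hw0, hℓ, hdom, hKP, hpin⟩ := hdata U hU lam hlam
    exact (gasZ_pos_and_abs_log_le hκ.le (w lam) wbar a ℓ U hw0 hℓ hdom hKP hpin).1
  have hlim : ∀ U : GaugeField (F.P J) 0 (Matrix.specialUnitaryGroup (Fin 2) ℂ), PlaqSmall (θBal F.L γ b₀ p₀ J) U →
      Tendsto (fun lam : ℝ => Real.log (polymerPartitionFunction polyInc (fun X : Finset (PBond (F.P J) 0) => ((w lam U X : ℝ) : ℂ)) Finset.univ).re) atTop (𝓝 0) :=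
    fun U hU => tendsto_log_gasZ_of_kpFamily hκ.le Nf hN w U (hdata U hU)
  refine ⟨Real.log (Cl 1) + Real.log (ell 1), w 1, hgas, fun U hU => ?_⟩
  have hsplit : ∀ lam : ℝ, 1 ≤ lam → ∀ U, U ∈ {U : GaugeField (F.P J) 0 (Matrix.specialUnitaryGroup (Fin 2) ℂ) | PlaqSmall (θBal F.L γ b₀ p₀ J) U} →
      (fun (lam : ℝ) (U : GaugeField (F.P J) 0 (Matrix.specialUnitaryGroup (Fin 2) ℂ)) =>
          Real.log (Node00.canonVersion (fieldMeasure (F.P J) 0 (Matrix.specialUnitaryGroup (Fin 2) ℂ))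
              (heightDensity F (γ / lam) hJK (histGood F ℰp (θBal F.L γ b₀ p₀) K J)) U)
            + (F.scheme ℰp (γ / lam)).β K * minActionRegPr F J K hJK ε₀ U) lam U
        = (fun lam : ℝ => Real.log (Cl lam)) lam + (fun U => Real.log (ell U)) U
          + (fun (lam : ℝ) (U : GaugeField (F.P J) 0 (Matrix.specialUnitaryGroup (Fin 2) ℂ)) => Real.log (polymerPartitionFunction polyInc (fun X : Finset (PBond (F.P J) 0) => ((w lam U X : ℝ) : ℂ)) Finset.univ).re) lam U :=
    fun lam hlam U hU => log_add_eq_of_mul_exp_eq (hCl lam hlam) (hell U hU) (hZpos lam hlam U hU) (hprod lam hlam U hU)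
  exact eq_const_add_limUnder_add_of_split hsplit (fun U hU => hlim U hU) hU h1

end Doors

end Summit.QuantumFields.YangMills.Theorems.LoopLedgerGasOfProductFormula

end
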